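import Literature.Probability.Percolation.FoldingFibresFourFunctions
import Literature.Probability.Percolation.Percolation
import HarnessLib

/-!
# The three-point diamond is FIBREWISE: the antipodal count inequality (PAPER-2 track (ii); seat `prim-consts-2`, gen 19)

builds on p205010 (kernel theorem, internal audit signed; external expert review pending).  Support file (`--supports
stmt-CriticalPhenomena-4575`); memo `run/shared/lean/prim/consts/FROM-prim-consts-2-g19-RIDER-EXCHANGE.md` §2.  Theorems only.

Gen 18 (memo FROM-prim-consts-2-g18-XEDGE-CROSS.md addendum (14)) observed numerically that the diamond `P(ac|b)·P(bc|a) ≤ P(abc)·P(a|b|c)` holds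
FIBRE BY FIBRE in the antipodal two-copy form — for every edge set `E` and vertices `a, b, c`,
  `#{η ⊆ E : η ∈ ac|b, E ∖ η ∈ bc|a} ≤ #{η ⊆ E : η ∈ abc, E ∖ η ∈ a|b|c}`
(0 violations on all simple graphs `n ≤ 5, m ≤ 7` and 3 000 random multigraphs) — and asked for a canonical injection.  No injection is needed:
the diamond is an Ahlswede–Daykin four-events inequality (a configuration of `ac|b` and one of `bc|a` meet in `a|b|c` and join in `abc`, tree:
`Consts.threePointDiamond_ineq`), and the four functions theorem holds on every folding fibre (Christofides' complementary-pairs theorem / Aharoni–Keich /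
Chan–Pak; tree: `FoldingFibre.fibreCount_le_of_fourEvents`).  The fibre `M = E, u = ∅` is exactly the antipodal pairing `η ↦ E ∖ η` of the subsets of `E`.
* `Consts.threePointDiamond_fibrewise` — the displayed count inequality, for every finite vertex type, every `E ⊆ Sym2 V` and all `a, b, c`.
[cite: Christofides2009, Thm. 2.2] [cite: AharoniKeich1996, Prop. 4.4] [cite: BollobasRiordan2006, Ch. 2 Thm. 7]
-/

noncomputable section

namespace Summit.CriticalPhenomena.PercolationContinuityZ3.Theorems

open Set
open scoped symmDiff Classical
open Literature.Probability.Percolation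

namespace Consts

variable {V : Type*} [Fintype V]

omit [Fintype V] in
/-- Reachability in the open graph is monotone in the configuration. [folklore] -/
private theorem reach_mono_cfg {ω ω' : BondConfig V} (h : ω ⊆ ω') {u v : V} (huv : (openGraph ω).Reachable u v) :
    (openGraph ω').Reachable u v :=
  huv.mono (BHK2006.openGraph_le h)

/-- **THEOREM (the diamond is fibrewise — antipodal count form).**  For every finite vertex type, every set `E` of pairs and vertices `a, b, c`:
`#{η ⊆ E : c↔a ∧ c↮b in η, and c↔b ∧ c↮a in E ∖ η} ≤ #{η ⊆ E : c↔a ∧ c↔b in η, and c↮a ∧ c↮b ∧ a↮b in E ∖ η}`.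
By Linusson's fibre principle this re-proves the diamond for every product measure; here it is the fibre `M = E`, `u = ∅` of the fibrewise four
functions theorem, fed with the four-events implication of `Consts.threePointDiamond_ineq`.
[cite: Christofides2009, Thm. 2.2 — corollary, derived here] -/
theorem threePointDiamond_fibrewise (E : Set (Sym2 V)) (a b c : V) :
    (Finset.univ.filter fun η : BondConfig V => η ⊆ E ∧
        ((openGraph η).Reachable c a ∧ ¬ (openGraph η).Reachable c b) ∧
        ((openGraph (E \ η)).Reachable c b ∧ ¬ (openGraph (E \ η)).Reachable c a)).card ≤
      (Finset.univ.filter fun η : BondConfig V => η ⊆ E ∧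
        ((openGraph η).Reachable c a ∧ (openGraph η).Reachable c b) ∧
        (¬ (openGraph (E \ η)).Reachable c a ∧ ¬ (openGraph (E \ η)).Reachable c b ∧
          ¬ (openGraph (E \ η)).Reachable a b)).card := by
  -- the four events
  let A₁ : Set (BondConfig V) := {ω | (openGraph ω).Reachable c a ∧ ¬ (openGraph ω).Reachable c b}
  let A₂ : Set (BondConfig V) := {ω | (openGraph ω).Reachable c b ∧ ¬ (openGraph ω).Reachable c a}
  let A₃ : Set (BondConfig V) := {ω | ¬ (openGraph ω).Reachable c a ∧ ¬ (openGraph ω).Reachable c b ∧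
    ¬ (openGraph ω).Reachable a b}
  let A₄ : Set (BondConfig V) := {ω | (openGraph ω).Reachable c a ∧ (openGraph ω).Reachable c b}
  have h : ∀ ω ∈ A₁, ∀ ω' ∈ A₂, ω ∩ ω' ∈ A₃ ∧ ω ∪ ω' ∈ A₄ := by
    intro ω hω ω' hω'
    simp only [A₁, A₂, A₃, A₄, mem_setOf_eq] at hω hω' ⊢
    obtain ⟨hca, hcb⟩ := hω
    obtain ⟨hcb', hca'⟩ := hω'
    exact ⟨⟨fun h => hca' (reach_mono_cfg inter_subset_right h), fun h => hcb (reach_mono_cfg inter_subset_left h),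
      fun h => hcb (hca.trans (reach_mono_cfg inter_subset_left h))⟩,
      reach_mono_cfg subset_union_left hca, reach_mono_cfg subset_union_right hcb'⟩
  have key := FoldingFibre.fibreCount_le_of_fourEvents h E ∅
  -- on the fibre `M = E`, `u = ∅`: `η \ E = ∅ ↔ η ⊆ E` and `η ∆ E = E \ η`
  have hsd : ∀ η : BondConfig V, η ⊆ E → η ∆ E = E \ η := fun η hη => by
    rw [Set.symmDiff_def, Set.sdiff_eq_empty.mpr hη, empty_union]
  have cL : (Finset.univ.filter fun η : BondConfig V => η ⊆ E ∧
        ((openGraph η).Reachable c a ∧ ¬ (openGraph η).Reachable c b) ∧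
        ((openGraph (E \ η)).Reachable c b ∧ ¬ (openGraph (E \ η)).Reachable c a)).card =
      (Finset.univ.filter fun η : BondConfig V => η \ E = ∅ ∧ η ∈ A₁ ∧ η ∆ E ∈ A₂).card := by
    refine Finset.card_bij (fun η _ => η) (fun η hη => ?_) (fun η₁ _ η₂ _ heq => heq) (fun η hη => ⟨η, ?_, rfl⟩)
    · simp only [Finset.mem_filter, Finset.mem_univ, true_and] at hη ⊢
      obtain ⟨hE, h1, h2⟩ := hη
      refine ⟨Set.sdiff_eq_empty.mpr hE, h1, ?_⟩
      rw [hsd η hE]; exact h2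
    · simp only [Finset.mem_filter, Finset.mem_univ, true_and] at hη ⊢
      obtain ⟨hE, h1, h2⟩ := hη
      have hE' : η ⊆ E := Set.sdiff_eq_empty.mp hE
      refine ⟨hE', h1, ?_⟩
      rw [hsd η hE'] at h2; exact h2
  have cR : (Finset.univ.filter fun η : BondConfig V => η \ E = ∅ ∧ η ∈ A₃ ∧ η ∆ E ∈ A₄).card =
      (Finset.univ.filter fun η : BondConfig V => η ⊆ E ∧
        ((openGraph η).Reachable c a ∧ (openGraph η).Reachable c b) ∧
        (¬ (openGraph (E \ η)).Reachable c a ∧ ¬ (openGraph (E \ η)).Reachable c b ∧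
          ¬ (openGraph (E \ η)).Reachable a b)).card := by
    -- re-index by the involution `η ↦ E \ η` of the subsets of `E`
    refine Finset.card_bij (fun η _ => E \ η) (fun η hη => ?_) (fun η₁ hη₁ η₂ hη₂ heq => ?_) (fun η hη => ?_)
    · simp only [Finset.mem_filter, Finset.mem_univ, true_and] at hη ⊢
      obtain ⟨hE, h1, h2⟩ := hη
      have hE' : η ⊆ E := Set.sdiff_eq_empty.mp hE
      rw [hsd η hE'] at h2
      refine ⟨Set.sdiff_subset, h2, ?_⟩
      rw [Set.sdiff_sdiff_cancel_left hE']; exact h1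
    · simp only [Finset.mem_filter, Finset.mem_univ, true_and] at hη₁ hη₂
      have h1 : η₁ ⊆ E := Set.sdiff_eq_empty.mp hη₁.1
      have h2 : η₂ ⊆ E := Set.sdiff_eq_empty.mp hη₂.1
      have := congrArg (fun s => E \ s) heq
      simp only [Set.sdiff_sdiff_cancel_left h1, Set.sdiff_sdiff_cancel_left h2] at this
      exact this
    · simp only [Finset.mem_filter, Finset.mem_univ, true_and] at hη
      obtain ⟨hE, h1, h2⟩ := hη
      refine ⟨E \ η, ?_, Set.sdiff_sdiff_cancel_left hE⟩
      simp only [Finset.mem_filter, Finset.mem_univ, true_and]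
      refine ⟨Set.sdiff_eq_empty.mpr Set.sdiff_subset, h2, ?_⟩
      rw [hsd _ Set.sdiff_subset, Set.sdiff_sdiff_cancel_left hE]; exact h1
  rw [cL, ← cR]
  convert key using 4

end Consts

end Summit.CriticalPhenomena.PercolationContinuityZ3.Theorems

end
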